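/-
Copyright (c) 2026 the pub-hodgecm-mathlib formalisation cell (harness21).  Prover seat hodgecm-mathlib-K2E4-p14 (g5), Track B ∕ K2-LIT, h413 =
`stmt-HodgeConjecture-24833`, line `K2_E1_TraceFormulaBeta`, campaign «EIS-RANK-ONE» rung R6f(iii); DEAL «EIS-R6f-iii» of the dealer K2E1-plan (g3)
2026-09-04T04:44:28Z, heads «=» 04:48:06Z.  PART 2∕2: THE HEADS — the Mellin shape behind the four Maass–Selberg terms, the brackets, the torus reading of the mirror term.
-/
import Summits.HodgeConjecture.HodgeConjecture.Theorems.K2E1IdeleClassMellinWeighted   -- PART 1∕2 (this seat): Tate at `T₀`, the weighted norm profile, orthogonality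
import Summits.HodgeConjecture.HodgeConjecture.Theorems.K2E1BorelParabolicIntegralU3    -- ★ p857444 (K2E4-p11 g3): `H(b) = ‖d₀ b‖`, the `≤`-side torus factor, ★ (C-torus) unfolding
import HarnessLib

/-!
# K2·E1 — `K2E1TorusHeightMellin`: `∫_{𝓕 ∩ {‖x‖ ≤ T₀}} ‖x‖^s Ψ dν = (T₀^s∕s)·[Ψ]` AND ITS MIRROR — THE LEMMA THE FOUR MAASS–SELBERG TERMS ARE MADE OF
# (campaign «EIS-RANK-ONE», rung R6f(iii), part 2∕2: Bochner heads, brackets `[1] = V`, `[η] = 0`, torus reading of the mirror term)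

Track B ∕ K2-LIT, crux h413 = `stmt-HodgeConjecture-24833`, route of record `HCCMUnconditional`; cell `hodgecm-mathlib`, squad K2, ENGINE E1.  Prover seat
`hodgecm-mathlib-K2E4-p14` (g5); DEAL «EIS-R6f-iii» of the dealer K2E1-plan (g3) (SPEC `SPEC-EIS-R6-MaassSelberg` §2 R6f(iii), §2′), heads «=» 2026-09-04T04:48:06Z: «§2 the
WEIGHTED shape `= (T₀^s∕s)·[ψ]`, `[ψ] := ∫_{{‖x‖≤1}∩𝓕} ‖x‖·ψ dν`, SAME bracket on the mirror; §3 `[1] = V`, `[η] = 0`; §4 the N = 3 `d₀`-torus reading».  THEOREMS ONLY (no `def`, no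
`instance`, no notation, no named-fact hypothesis, no `sorry`); lane `--supports stmt-HodgeConjecture-24833 --as helper` (count-neutral).  Closes no socket.

THE MATHEMATICS.  `K` a number field, `ν` a Haar measure on `𝕀_K`, `𝓕` an idele class domain (★ `IsIdeleClassDomain`), `V = idelicCovolume K ν`, `M = z(ℝ_{>0})` (★ `posRealIdele`).
The torus quotient `T(F)∖T(𝔸_F)` of `U(Φ₂)`∕`U(Φ₃)` is read on `E^×∖𝕀_E` along `d₀` (★ `UnitaryGroupTorusIdeleUnfolding`, ★ `UnitaryGroupTorusLineUnfoldingTwo`) with `H(t g) = ‖d₀ t‖·H(g)`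
(★ `borelHeight_torus_mul'`, ★ p857444 `borelHeight_coe_eq_ideleNorm_diagUnit`), so the four torus integrals of the rank-one Maass–Selberg relation [MoeglinWaldspurger1995, IV.2.1;
Garrett2018, §11.3; Arthur1980TraceFormulaII, §4] are, for `Ψ` = the `K × (T(F)∖T¹(𝔸))`-part of `f · conj f′` (measurable, bounded, `K^×`- and `M`-invariant), `Re s > 0`, `T₀ > 0`:
* §2 **THE HEADS**: **`∫_{𝓕 ∩ {‖x‖ ≤ T₀}} ‖x‖^s Ψ dν = (T₀^s∕s)·[Ψ]`** and **`∫_{𝓕 ∩ {T₀ < ‖x‖}} ‖x‖^{-s} Ψ dν = (T₀^{-s}∕s)·[Ψ]`** (with integrability) — the SAME bracket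
  **`[Ψ] = ∫_{𝓕 ∩ {‖x‖ ≤ 1}} ‖x‖ Ψ dν`** `= ∫_{𝓕 ∩ {0 ≤ log ‖x‖ < 1}} Ψ dν` (`bracket_eq_shellIntegral`), visibly linear in `Ψ` and `≥ 0` for `Ψ ≥ 0` (what the positivity step of
  [MoeglinWaldspurger1995, IV.3] reads); §1 is the engine (Bochner form of part 1's weighted norm profile; complex weights by `Ψ = Ψ₁ − Ψ₂ + i(Ψ₃ − Ψ₄)`).
* §3 **`[1] = V`** (★ Tate) and **`[η] = 0`** for a multiplicative `η` trivial on `K^×·M` with `η ≢ 1` (part 1's orthogonality).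
* §4 the `ℝ≥0∞` torus reading of the MIRROR term on `U(J₃)`: `∫ 𝟙{C₀ < H(t)} H(t)^{-σ} w_T dμ_T = K₁ · C₀^{-σ}∕σ` for every covering weight of `T(F)_T` — the twin of the `≤`-side ★ p857444
  `exists_lintegral_indicator_borelHeight_rpow_mul_weight_torus_eq` (not restated).  Integrands depending on the `U(1)`-coordinate of `T` are not covered by the `d₀`-reading (honest).
HONEST LABEL: HC_CM is proved only modulo the 7 printed citations (2 remaining named inputs: hLiu418 = `stmt-HodgeConjecture-24832`, h413 = `stmt-HodgeConjecture-24833`) until rung 0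
closes; this file asserts no named fact and closes no socket.
References: [MoeglinWaldspurger1995] Mœglin–Waldspurger, *Spectral Decomposition and Eisenstein Series* (1995), IV.2.1, IV.3 · [Garrett2018] §11.3 · [Arthur1980TraceFormulaII]
J. Arthur, Compositio Math. 40 (1980), §4 · [CasselsFrohlichANT1967] J. Tate, in Cassels–Fröhlich (1967), Ch. XV §4.3–4.4 · [Rogawski1990] §2.2, §7.3 · [WeilBNT1967] Ch. VII §5.
-/

set_option autoImplicit false
-- the mandated namespace repeats the single-problem summit's segment (`HodgeConjecture.HodgeConjecture`)
set_option linter.dupNamespace false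

noncomputable section

open MeasureTheory Measure NumberField IsDedekindDomain Set Filter
open scoped ENNReal NNReal Pointwise Topology
open Literature.NumberTheory Literature.NumberTheory.Automorphic
open Summit.HodgeConjecture.HodgeConjecture.Cruxes.H413.K2E1IdeleClassMellinWeighted

namespace Summit.HodgeConjecture.HodgeConjecture.Cruxes.H413.K2E1TorusHeightMellin

variable {K : Type} [Field K] [NumberField K]

/-! ## §0 Pointwise identities -/

/-- The four-part decomposition `Ψ = (re Ψ)⁺ − (−re Ψ)⁺ + i((im Ψ)⁺ − (−im Ψ)⁺)`, pointwise. [folklore] -/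
theorem fourParts {Ψ : GaloisRepresentations.ideleGroup K → ℂ} (x : GaloisRepresentations.ideleGroup K) :
    Ψ x = (((Ψ x).re.toNNReal : ℝ) : ℂ) - ((((-(Ψ x).re).toNNReal : ℝ≥0) : ℝ) : ℂ)
      + Complex.I * ((((Ψ x).im.toNNReal : ℝ) : ℂ) - ((((-(Ψ x).im).toNNReal : ℝ≥0) : ℝ) : ℂ)) := by
  have hre : (((Ψ x).re.toNNReal : ℝ) : ℂ) - ((((-(Ψ x).re).toNNReal : ℝ≥0) : ℝ) : ℂ) = ((Ψ x).re : ℂ) := by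
    rw [← Complex.ofReal_sub, Real.coe_toNNReal', Real.coe_toNNReal', max_zero_sub_max_neg_zero_eq_self]
  have him : (((Ψ x).im.toNNReal : ℝ) : ℂ) - ((((-(Ψ x).im).toNNReal : ℝ≥0) : ℝ) : ℂ) = ((Ψ x).im : ℂ) := by
    rw [← Complex.ofReal_sub, Real.coe_toNNReal', Real.coe_toNNReal', max_zero_sub_max_neg_zero_eq_self]
  rw [hre, him, mul_comm, Complex.re_add_im]

/-- `𝟙{T₀ < ‖x‖} · ‖x‖^{-σ}` is the indicator of `(log T₀, ∞)` times `e^{-σu}` at `u = log ‖x‖`. [folklore] -/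
theorem indicator_lt_rpow_neg_eq_comp_logNorm {T₀ : ℝ} (hT : 0 < T₀) (σ : ℝ) :
    (fun x : GaloisRepresentations.ideleGroup K => {x : GaloisRepresentations.ideleGroup K | T₀ < (IdeleClassGroup.ideleNorm K x : ℝ)}.indicator
        (fun x => ENNReal.ofReal ((IdeleClassGroup.ideleNorm K x : ℝ) ^ (-σ))) x) =
      (fun u : ℝ => (Ioi (Real.log T₀)).indicator (fun u => ENNReal.ofReal (Real.exp (-σ * u))) u) ∘ logNorm K := by
  have h : (fun x : GaloisRepresentations.ideleGroup K => ENNReal.ofReal ((IdeleClassGroup.ideleNorm K x : ℝ) ^ (-σ))) =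
      (fun u : ℝ => ENNReal.ofReal (Real.exp (-σ * u))) ∘ logNorm K := by
    funext y
    simp only [Function.comp_apply, logNorm]
    rw [Real.rpow_def_of_pos (ideleNorm_real_pos y), mul_comm]
  funext x
  rw [setOf_lt_ideleNorm_eq hT, h, Function.comp_apply]
  exact Set.indicator_comp_right _

/-! ## §1 The Bochner form of the weighted norm profile: `ℝ≥0`-valued weights, then complex weights -/

section Bochner

variable [MeasurableSpace (GaloisRepresentations.ideleGroup K)] [BorelSpace (GaloisRepresentations.ideleGroup K)]

/-- A bounded measurable function is integrable on a norm shell inside `𝓕` (finite `ν`-measure, ★ `measure_logNorm_preimage_Icc_inter_lt_top`). [folklore] -/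
theorem integrableOn_logNorm_preimage_Icc_inter_of_bounded (ν : Measure (GaloisRepresentations.ideleGroup K)) [ν.IsMulLeftInvariant]
    [IsFiniteMeasureOnCompacts ν] {𝓕 : Set (GaloisRepresentations.ideleGroup K)} (h𝓕 : IsIdeleClassDomain K 𝓕)
    {Ψ : GaloisRepresentations.ideleGroup K → ℂ} (hΨ : Measurable Ψ) {C : ℝ} (hΨC : ∀ x, ‖Ψ x‖ ≤ C) (a b : ℝ) :
    IntegrableOn Ψ (logNorm K ⁻¹' Icc a b ∩ 𝓕) ν :=
  Measure.integrableOn_of_bounded (measure_logNorm_preimage_Icc_inter_lt_top ν (h𝓕.isFundamentalDomain ν) a b).ne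
    hΨ.aestronglyMeasurable (Eventually.of_forall hΨC)

/-- **Weighted integration along the norm, Bochner version for an `ℝ≥0`-valued weight**: for `f` integrable on `B`,
`x ↦ f(log ‖x‖) ψ(x)` is integrable on `{log ‖x‖ ∈ B} ∩ 𝓕` and `∫ f(log ‖x‖) ψ(x) dν = (∫_{{0 ≤ log ‖x‖ < 1} ∩ 𝓕} ψ dν) · ∫_B f`. [folklore] -/
theorem integrableOn_and_setIntegral_comp_logNorm_mul_nnreal (ν : Measure (GaloisRepresentations.ideleGroup K)) [ν.IsMulLeftInvariant]
    [IsFiniteMeasureOnCompacts ν] [ν.IsOpenPosMeasure] {𝓕 : Set (GaloisRepresentations.ideleGroup K)} (h𝓕 : IsIdeleClassDomain K 𝓕)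
    {ψ : GaloisRepresentations.ideleGroup K → ℝ≥0} (hψ : Measurable ψ) {C : ℝ≥0} (hψC : ∀ x, ψ x ≤ C)
    (hψK : ∀ k ∈ GaloisRepresentations.principalIdeles K, ∀ x, ψ (k * x) = ψ x)
    (hψM : ∀ (r : ℝ≥0ˣ) (x : GaloisRepresentations.ideleGroup K), ψ (posRealIdele K r * x) = ψ x)
    {B : Set ℝ} (hB : MeasurableSet B) {f : ℝ → ℂ} (hf : IntegrableOn f B) :
    IntegrableOn (fun x => f (logNorm K x) * ((ψ x : ℝ) : ℂ)) (logNorm K ⁻¹' B ∩ 𝓕) ν ∧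
      ∫ x in logNorm K ⁻¹' B ∩ 𝓕, f (logNorm K x) * ((ψ x : ℝ) : ℂ) ∂ν =
        (∫ x in logNorm K ⁻¹' Ico 0 1 ∩ 𝓕, ((ψ x : ℝ) : ℂ) ∂ν) * ∫ u in B, f u := by
  have h𝓕ν := h𝓕.isFundamentalDomain ν
  have hA : MeasurableSet (logNorm K ⁻¹' B ∩ 𝓕) := (measurableSet_logNorm_preimage hB).inter h𝓕.measurableSet
  have hψC' : ∀ x, (ψ x : ℝ≥0∞) ≤ (C : ℝ≥0) := fun x => ENNReal.coe_le_coe.2 (hψC x)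
  have hψK' : ∀ k ∈ GaloisRepresentations.principalIdeles K, ∀ x, (ψ (k * x) : ℝ≥0∞) = ψ x := fun k hk x => by rw [hψK k hk x]
  have hψM' : ∀ (r : ℝ≥0ˣ) (x : GaloisRepresentations.ideleGroup K), (ψ (posRealIdele K r * x) : ℝ≥0∞) = ψ x := fun r x => by rw [hψM r x]
  have hfi : IntegrableOn (fun x => f (logNorm K x)) (logNorm K ⁻¹' B ∩ 𝓕) ν :=
    (integrableOn_comp_logNorm_iff ν h𝓕ν hB hf.aestronglyMeasurable).2 hf
  have hψcm : Measurable fun x => ((ψ x : ℝ) : ℂ) := Complex.measurable_ofReal.comp hψ.coe_nnreal_real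
  have hint : IntegrableOn (fun x => f (logNorm K x) * ((ψ x : ℝ) : ℂ)) (logNorm K ⁻¹' B ∩ 𝓕) ν :=
    (Integrable.bdd_mul (c := (C : ℝ)) hfi hψcm.aestronglyMeasurable (Eventually.of_forall fun x => by
      rw [Complex.norm_real, Real.norm_eq_abs, NNReal.abs_eq]; exact hψC x)).congr (Eventually.of_forall fun x => mul_comm _ _)
  refine ⟨hint, ?_⟩
  have hshell : IntegrableOn (fun x => (ψ x : ℝ)) (logNorm K ⁻¹' Ico 0 1 ∩ 𝓕) ν := by
    refine Measure.integrableOn_of_bounded (M := (C : ℝ)) ?_ hψ.coe_nnreal_real.aestronglyMeasurable (Eventually.of_forall fun x => ?_)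
    · exact ((measure_mono (Set.inter_subset_inter_left _ (Set.preimage_mono Set.Ico_subset_Icc_self))).trans_lt
        (measure_logNorm_preimage_Icc_inter_lt_top ν h𝓕ν 0 1)).ne
    · rw [Real.norm_eq_abs, NNReal.abs_eq]; exact hψC x
  have hc : ((ν.withDensity (fun x => (ψ x : ℝ≥0∞)) (logNorm K ⁻¹' Ico 0 1 ∩ 𝓕)).toReal : ℂ) =
      ∫ x in logNorm K ⁻¹' Ico 0 1 ∩ 𝓕, ((ψ x : ℝ) : ℂ) ∂ν := by
    rw [withDensity_apply _ ((measurableSet_logNorm_preimage measurableSet_Ico).inter h𝓕.measurableSet), lintegral_coe_eq_integral _ hshell,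
      ENNReal.toReal_ofReal, integral_complex_ofReal]
    exact integral_nonneg fun x => (ψ x).2
  have hfm : AEStronglyMeasurable f (Measure.map (logNorm K) ((ν.withDensity fun x => (ψ x : ℝ≥0∞)).restrict (logNorm K ⁻¹' B ∩ 𝓕))) := by
    rw [map_logNorm_restrict_withDensity_eq ν h𝓕ν hψC' hψK' hψM' hB]
    exact hf.aestronglyMeasurable.smul_measure _
  calc ∫ x in logNorm K ⁻¹' B ∩ 𝓕, f (logNorm K x) * ((ψ x : ℝ) : ℂ) ∂ν
      = ∫ x in logNorm K ⁻¹' B ∩ 𝓕, ψ x • f (logNorm K x) ∂ν := by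
        refine setIntegral_congr_fun hA fun x _ => ?_
        rw [NNReal.smul_def, Complex.real_smul, mul_comm]
    _ = ∫ x in logNorm K ⁻¹' B ∩ 𝓕, f (logNorm K x) ∂(ν.withDensity fun x => (ψ x : ℝ≥0∞)) :=
        (setIntegral_withDensity_eq_setIntegral_smul hψ _ hA).symm
    _ = ∫ u, f u ∂(Measure.map (logNorm K) ((ν.withDensity fun x => (ψ x : ℝ≥0∞)).restrict (logNorm K ⁻¹' B ∩ 𝓕))) :=
        (integral_map (continuous_logNorm K).measurable.aemeasurable hfm).symm
    _ = (∫ x in logNorm K ⁻¹' Ico 0 1 ∩ 𝓕, ((ψ x : ℝ) : ℂ) ∂ν) * ∫ u in B, f u := by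
        rw [map_logNorm_restrict_withDensity_eq ν h𝓕ν hψC' hψK' hψM' hB, integral_smul_measure, ← hc, Complex.real_smul]

/-- **Weighted integration along the norm — complex weights.**  For `Ψ : 𝕀_K → ℂ` measurable, bounded, `K^×`-invariant and `M`-invariant, `B ⊆ ℝ` Borel and `f` integrable on `B`:
`x ↦ f(log ‖x‖) Ψ(x)` is integrable on `{log ‖x‖ ∈ B} ∩ 𝓕` and **`∫_{{log ‖x‖ ∈ B} ∩ 𝓕} f(log ‖x‖) Ψ(x) dν = (∫_{{0 ≤ log ‖x‖ < 1} ∩ 𝓕} Ψ dν) · ∫_B f(u) du`** — the idele class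
group disintegrates as `(𝕀_K¹∕K^×) × ℝ` with `dν = dν¹ du`, and `Ψ` lives on the compact factor. [cite: CasselsFrohlichANT1967, Ch. XV Thm. 4.3.2] [cite: WeilBNT1967, Ch. VII §5] -/
theorem integrableOn_and_setIntegral_comp_logNorm_mul (ν : Measure (GaloisRepresentations.ideleGroup K)) [ν.IsMulLeftInvariant]
    [IsFiniteMeasureOnCompacts ν] [ν.IsOpenPosMeasure] {𝓕 : Set (GaloisRepresentations.ideleGroup K)} (h𝓕 : IsIdeleClassDomain K 𝓕)
    {Ψ : GaloisRepresentations.ideleGroup K → ℂ} (hΨ : Measurable Ψ) {C : ℝ} (hΨC : ∀ x, ‖Ψ x‖ ≤ C)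
    (hΨK : ∀ k ∈ GaloisRepresentations.principalIdeles K, ∀ x, Ψ (k * x) = Ψ x)
    (hΨM : ∀ (r : ℝ≥0ˣ) (x : GaloisRepresentations.ideleGroup K), Ψ (posRealIdele K r * x) = Ψ x)
    {B : Set ℝ} (hB : MeasurableSet B) {f : ℝ → ℂ} (hf : IntegrableOn f B) :
    IntegrableOn (fun x => f (logNorm K x) * Ψ x) (logNorm K ⁻¹' B ∩ 𝓕) ν ∧
      ∫ x in logNorm K ⁻¹' B ∩ 𝓕, f (logNorm K x) * Ψ x ∂ν = (∫ x in logNorm K ⁻¹' Ico 0 1 ∩ 𝓕, Ψ x ∂ν) * ∫ u in B, f u := by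
  have hC0 : 0 ≤ C := (norm_nonneg _).trans (hΨC 1)
  -- the four `ℝ≥0`-parts, each measurable, bounded by `C.toNNReal`, `K^×`- and `M`-invariant
  have hpart : ∀ (L : ℂ → ℝ), Measurable L → (∀ z, |L z| ≤ ‖z‖) →
      IntegrableOn (fun x => f (logNorm K x) * (((L (Ψ x)).toNNReal : ℝ) : ℂ)) (logNorm K ⁻¹' B ∩ 𝓕) ν ∧
      ∫ x in logNorm K ⁻¹' B ∩ 𝓕, f (logNorm K x) * (((L (Ψ x)).toNNReal : ℝ) : ℂ) ∂ν =
        (∫ x in logNorm K ⁻¹' Ico 0 1 ∩ 𝓕, (((L (Ψ x)).toNNReal : ℝ) : ℂ) ∂ν) * ∫ u in B, f u := by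
    intro L hL hLz
    refine integrableOn_and_setIntegral_comp_logNorm_mul_nnreal ν h𝓕 (ψ := fun x => (L (Ψ x)).toNNReal)
      ((hL.comp hΨ).real_toNNReal) (C := C.toNNReal) (fun x => ?_) (fun k hk x => by simp only [hΨK k hk x])
      (fun r x => by simp only [hΨM r x]) hB hf
    exact Real.toNNReal_le_toNNReal (((le_abs_self _).trans (hLz _)).trans (hΨC x))
  obtain ⟨i1, e1⟩ := hpart (fun z => z.re) Complex.measurable_re (fun z => Complex.abs_re_le_norm z)
  obtain ⟨i2, e2⟩ := hpart (fun z => -z.re) Complex.measurable_re.neg (fun z => by rw [abs_neg]; exact Complex.abs_re_le_norm z)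
  obtain ⟨i3, e3⟩ := hpart (fun z => z.im) Complex.measurable_im (fun z => Complex.abs_im_le_norm z)
  obtain ⟨i4, e4⟩ := hpart (fun z => -z.im) Complex.measurable_im.neg (fun z => by rw [abs_neg]; exact Complex.abs_im_le_norm z)
  -- integrability of `f(log ‖x‖) Ψ(x)`: bounded scalar times the integrable `f ∘ log ‖·‖`
  have hfi : IntegrableOn (fun x => f (logNorm K x)) (logNorm K ⁻¹' B ∩ 𝓕) ν :=
    (integrableOn_comp_logNorm_iff ν (h𝓕.isFundamentalDomain ν) hB hf.aestronglyMeasurable).2 hf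
  have hint : IntegrableOn (fun x => f (logNorm K x) * Ψ x) (logNorm K ⁻¹' B ∩ 𝓕) ν :=
    (Integrable.bdd_mul (c := C) hfi hΨ.aestronglyMeasurable (Eventually.of_forall hΨC)).congr (Eventually.of_forall fun x => mul_comm _ _)
  refine ⟨hint, ?_⟩
  -- the shell integrals of the four parts are finite
  have hs : ∀ (L : ℂ → ℝ), Measurable L → (∀ z, |L z| ≤ ‖z‖) →
      IntegrableOn (fun x => (((L (Ψ x)).toNNReal : ℝ) : ℂ)) (logNorm K ⁻¹' Ico 0 1 ∩ 𝓕) ν := by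
    intro L hL hLz
    refine (integrableOn_logNorm_preimage_Icc_inter_of_bounded ν h𝓕 (Complex.measurable_ofReal.comp ((hL.comp hΨ).real_toNNReal).coe_nnreal_real)
      (C := C) (fun x => ?_) 0 1).mono_set (Set.inter_subset_inter_left _ (Set.preimage_mono Set.Ico_subset_Icc_self))
    simp only [Function.comp_apply, Complex.norm_real, Real.norm_eq_abs, NNReal.abs_eq]
    rw [Real.coe_toNNReal']
    exact max_le (((le_abs_self _).trans (hLz _)).trans (hΨC x)) hC0
  have s1 := hs (fun z => z.re) Complex.measurable_re (fun z => Complex.abs_re_le_norm z)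
  have s2 := hs (fun z => -z.re) Complex.measurable_re.neg (fun z => by rw [abs_neg]; exact Complex.abs_re_le_norm z)
  have s3 := hs (fun z => z.im) Complex.measurable_im (fun z => Complex.abs_im_le_norm z)
  have s4 := hs (fun z => -z.im) Complex.measurable_im.neg (fun z => by rw [abs_neg]; exact Complex.abs_im_le_norm z)
  -- assemble: `Ψ = A₁ − A₂ + i(A₃ − A₄)` pointwise, then linearity of the integral on both sides
  have hΨ4 : ∀ x, Ψ x = (((Ψ x).re.toNNReal : ℝ) : ℂ) - ((((-(Ψ x).re).toNNReal : ℝ≥0) : ℝ) : ℂ)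
      + Complex.I * ((((Ψ x).im.toNNReal : ℝ) : ℂ) - ((((-(Ψ x).im).toNNReal : ℝ≥0) : ℝ) : ℂ)) := fun x => fourParts x
  have i12 : IntegrableOn (fun x => f (logNorm K x) * (((Ψ x).re.toNNReal : ℝ) : ℂ) - f (logNorm K x) * ((((-(Ψ x).re).toNNReal : ℝ≥0) : ℝ) : ℂ))
      (logNorm K ⁻¹' B ∩ 𝓕) ν := i1.sub i2
  have i34 : IntegrableOn (fun x => Complex.I * (f (logNorm K x) * (((Ψ x).im.toNNReal : ℝ) : ℂ) - f (logNorm K x) * ((((-(Ψ x).im).toNNReal : ℝ≥0) : ℝ) : ℂ)))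
      (logNorm K ⁻¹' B ∩ 𝓕) ν := (i3.sub i4).const_mul Complex.I
  have hL : ∫ x in logNorm K ⁻¹' B ∩ 𝓕, f (logNorm K x) * Ψ x ∂ν =
      ((∫ x in logNorm K ⁻¹' B ∩ 𝓕, f (logNorm K x) * (((Ψ x).re.toNNReal : ℝ) : ℂ) ∂ν)
        - ∫ x in logNorm K ⁻¹' B ∩ 𝓕, f (logNorm K x) * ((((-(Ψ x).re).toNNReal : ℝ≥0) : ℝ) : ℂ) ∂ν)
      + Complex.I * ((∫ x in logNorm K ⁻¹' B ∩ 𝓕, f (logNorm K x) * (((Ψ x).im.toNNReal : ℝ) : ℂ) ∂ν)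
        - ∫ x in logNorm K ⁻¹' B ∩ 𝓕, f (logNorm K x) * ((((-(Ψ x).im).toNNReal : ℝ≥0) : ℝ) : ℂ) ∂ν) := by
    calc ∫ x in logNorm K ⁻¹' B ∩ 𝓕, f (logNorm K x) * Ψ x ∂ν
        = ∫ x in logNorm K ⁻¹' B ∩ 𝓕, ((f (logNorm K x) * (((Ψ x).re.toNNReal : ℝ) : ℂ) - f (logNorm K x) * ((((-(Ψ x).re).toNNReal : ℝ≥0) : ℝ) : ℂ))
            + Complex.I * (f (logNorm K x) * (((Ψ x).im.toNNReal : ℝ) : ℂ) - f (logNorm K x) * ((((-(Ψ x).im).toNNReal : ℝ≥0) : ℝ) : ℂ))) ∂ν :=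
          integral_congr_ae (Eventually.of_forall fun x => by linear_combination (f (logNorm K x)) * hΨ4 x)
      _ = _ := by rw [integral_add i12 i34, integral_sub i1 i2, integral_const_mul, integral_sub i3 i4]
  have j12 : IntegrableOn (fun x => (((Ψ x).re.toNNReal : ℝ) : ℂ) - ((((-(Ψ x).re).toNNReal : ℝ≥0) : ℝ) : ℂ)) (logNorm K ⁻¹' Ico 0 1 ∩ 𝓕) ν := s1.sub s2
  have j34 : IntegrableOn (fun x => Complex.I * ((((Ψ x).im.toNNReal : ℝ) : ℂ) - ((((-(Ψ x).im).toNNReal : ℝ≥0) : ℝ) : ℂ))) (logNorm K ⁻¹' Ico 0 1 ∩ 𝓕) ν :=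
    (s3.sub s4).const_mul Complex.I
  have hR : ∫ x in logNorm K ⁻¹' Ico 0 1 ∩ 𝓕, Ψ x ∂ν =
      ((∫ x in logNorm K ⁻¹' Ico 0 1 ∩ 𝓕, (((Ψ x).re.toNNReal : ℝ) : ℂ) ∂ν) - ∫ x in logNorm K ⁻¹' Ico 0 1 ∩ 𝓕, ((((-(Ψ x).re).toNNReal : ℝ≥0) : ℝ) : ℂ) ∂ν)
      + Complex.I * ((∫ x in logNorm K ⁻¹' Ico 0 1 ∩ 𝓕, (((Ψ x).im.toNNReal : ℝ) : ℂ) ∂ν) - ∫ x in logNorm K ⁻¹' Ico 0 1 ∩ 𝓕, ((((-(Ψ x).im).toNNReal : ℝ≥0) : ℝ) : ℂ) ∂ν) := by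
    calc ∫ x in logNorm K ⁻¹' Ico 0 1 ∩ 𝓕, Ψ x ∂ν
        = ∫ x in logNorm K ⁻¹' Ico 0 1 ∩ 𝓕, ((((Ψ x).re.toNNReal : ℝ) : ℂ) - ((((-(Ψ x).re).toNNReal : ℝ≥0) : ℝ) : ℂ)
            + Complex.I * ((((Ψ x).im.toNNReal : ℝ) : ℂ) - ((((-(Ψ x).im).toNNReal : ℝ≥0) : ℝ) : ℂ))) ∂ν := integral_congr_ae (Eventually.of_forall hΨ4)
      _ = _ := by rw [integral_add j12 j34, integral_sub s1 s2, integral_const_mul, integral_sub s3 s4]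
  rw [hL, hR, e1, e2, e3, e4]
  ring

end Bochner

/-! ## §2 THE HEADS: the Mellin shape with the bracket `[Ψ] = ∫_{𝓕 ∩ {‖x‖ ≤ 1}} ‖x‖ Ψ dν` -/

section Mellin

variable [MeasurableSpace (GaloisRepresentations.ideleGroup K)] [BorelSpace (GaloisRepresentations.ideleGroup K)]

/-- **THE BRACKET IS THE WEIGHTED COVOLUME**: `[ψ] := ∫_{𝓕 ∩ {‖x‖ ≤ 1}} ‖x‖·ψ dν = ∫_{𝓕 ∩ {0 ≤ log ‖x‖ < 1}} ψ dν` (the `s = 1`, `T₀ = 1` instance of the weighted profile: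
`∫_{u ≤ 0} e^{u} du = 1`). [folklore] -/
theorem bracket_eq_shellIntegral (ν : Measure (GaloisRepresentations.ideleGroup K)) [ν.IsMulLeftInvariant]
    [IsFiniteMeasureOnCompacts ν] [ν.IsOpenPosMeasure] {𝓕 : Set (GaloisRepresentations.ideleGroup K)} (h𝓕 : IsIdeleClassDomain K 𝓕)
    {Ψ : GaloisRepresentations.ideleGroup K → ℂ} (hΨ : Measurable Ψ) {C : ℝ} (hΨC : ∀ x, ‖Ψ x‖ ≤ C)
    (hΨK : ∀ k ∈ GaloisRepresentations.principalIdeles K, ∀ x, Ψ (k * x) = Ψ x)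
    (hΨM : ∀ (r : ℝ≥0ˣ) (x : GaloisRepresentations.ideleGroup K), Ψ (posRealIdele K r * x) = Ψ x) :
    ∫ x in {x | (IdeleClassGroup.ideleNorm K x : ℝ) ≤ 1} ∩ 𝓕, ((IdeleClassGroup.ideleNorm K x : ℝ) : ℂ) * Ψ x ∂ν =
      ∫ x in logNorm K ⁻¹' Ico 0 1 ∩ 𝓕, Ψ x ∂ν := by
  have hfun : ∀ x : GaloisRepresentations.ideleGroup K, ((IdeleClassGroup.ideleNorm K x : ℝ) : ℂ) = (fun u : ℝ => Complex.exp ((1 : ℂ) * u)) (logNorm K x) := by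
    intro x; rw [← Complex.cpow_one ((IdeleClassGroup.ideleNorm K x : ℝ) : ℂ)]; exact ideleNorm_cpow_eq_exp x 1
  simp_rw [hfun]
  rw [setOf_ideleNorm_le_one_eq, (integrableOn_and_setIntegral_comp_logNorm_mul ν h𝓕 hΨ hΨC hΨK hΨM measurableSet_Iic
    (integrableOn_exp_mul_complex_Iic (a := 1) (by norm_num) 0)).2, integral_exp_mul_complex_Iic (by norm_num : (0 : ℝ) < (1 : ℂ).re)]
  simp

/-- **THE MELLIN SHAPE BELOW THE THRESHOLD** (`Re s > 0`, `T₀ > 0`; `Ψ` measurable, bounded, `K^×`-invariant and `M`-invariant):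
`x ↦ ‖x‖^s Ψ(x)` is integrable on `𝓕 ∩ {‖x‖ ≤ T₀}` and **`∫_{𝓕 ∩ {‖x‖ ≤ T₀}} ‖x‖^s Ψ(x) dν = (T₀^s ∕ s) · [Ψ]`**, `[Ψ] = ∫_{𝓕 ∩ {‖x‖ ≤ 1}} ‖x‖ Ψ dν` — the term
`[f, f′] T^{z + z̄′ − 2ρ}∕(z + z̄′ − 2ρ)` of the Maass–Selberg relation with `Ψ = ` the `K × (T(F)∖T¹(𝔸))`-part of `f · f̄′`.
[cite: MoeglinWaldspurger1995, IV.2.1] [cite: Garrett2018, §11.3] [cite: Arthur1980TraceFormulaII, §4] -/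
theorem integrableOn_and_setIntegral_ideleNorm_cpow_mul_of_le (ν : Measure (GaloisRepresentations.ideleGroup K)) [ν.IsMulLeftInvariant]
    [IsFiniteMeasureOnCompacts ν] [ν.IsOpenPosMeasure] {𝓕 : Set (GaloisRepresentations.ideleGroup K)} (h𝓕 : IsIdeleClassDomain K 𝓕)
    {Ψ : GaloisRepresentations.ideleGroup K → ℂ} (hΨ : Measurable Ψ) {C : ℝ} (hΨC : ∀ x, ‖Ψ x‖ ≤ C)
    (hΨK : ∀ k ∈ GaloisRepresentations.principalIdeles K, ∀ x, Ψ (k * x) = Ψ x)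
    (hΨM : ∀ (r : ℝ≥0ˣ) (x : GaloisRepresentations.ideleGroup K), Ψ (posRealIdele K r * x) = Ψ x)
    {s : ℂ} (hs : 0 < s.re) {T₀ : ℝ} (hT : 0 < T₀) :
    IntegrableOn (fun x => ((IdeleClassGroup.ideleNorm K x : ℝ) : ℂ) ^ s * Ψ x) ({x | (IdeleClassGroup.ideleNorm K x : ℝ) ≤ T₀} ∩ 𝓕) ν ∧
      ∫ x in {x | (IdeleClassGroup.ideleNorm K x : ℝ) ≤ T₀} ∩ 𝓕, ((IdeleClassGroup.ideleNorm K x : ℝ) : ℂ) ^ s * Ψ x ∂ν =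
        (((T₀ : ℝ) : ℂ) ^ s / s) * ∫ x in {x | (IdeleClassGroup.ideleNorm K x : ℝ) ≤ 1} ∩ 𝓕, ((IdeleClassGroup.ideleNorm K x : ℝ) : ℂ) * Ψ x ∂ν := by
  have hfun : ∀ x : GaloisRepresentations.ideleGroup K, ((IdeleClassGroup.ideleNorm K x : ℝ) : ℂ) ^ s = (fun u : ℝ => Complex.exp (s * u)) (logNorm K x) :=
    fun x => ideleNorm_cpow_eq_exp x s
  simp_rw [hfun]
  rw [setOf_ideleNorm_le_eq hT, bracket_eq_shellIntegral ν h𝓕 hΨ hΨC hΨK hΨM]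
  obtain ⟨hi, he⟩ := integrableOn_and_setIntegral_comp_logNorm_mul ν h𝓕 hΨ hΨC hΨK hΨM measurableSet_Iic (integrableOn_exp_mul_complex_Iic hs (Real.log T₀))
  refine ⟨hi, ?_⟩
  rw [he, integral_exp_mul_complex_Iic hs, ← ofReal_cpow_eq_exp hT, mul_comm]

/-- **THE MELLIN SHAPE ABOVE THE THRESHOLD** — the mirror, with the SAME bracket: `x ↦ ‖x‖^{-s} Ψ(x)` is integrable on `𝓕 ∩ {T₀ < ‖x‖}` and
**`∫_{𝓕 ∩ {T₀ < ‖x‖}} ‖x‖^{-s} Ψ(x) dν = (T₀^{-s} ∕ s) · [Ψ]`** (`Re s > 0`, `T₀ > 0`) — the terms carrying `𝟙_{>T} M f` of the Maass–Selberg relation.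
[cite: MoeglinWaldspurger1995, IV.2.1] [cite: Garrett2018, §11.3] [cite: Arthur1980TraceFormulaII, §4] -/
theorem integrableOn_and_setIntegral_ideleNorm_cpow_neg_mul_of_lt (ν : Measure (GaloisRepresentations.ideleGroup K)) [ν.IsMulLeftInvariant]
    [IsFiniteMeasureOnCompacts ν] [ν.IsOpenPosMeasure] {𝓕 : Set (GaloisRepresentations.ideleGroup K)} (h𝓕 : IsIdeleClassDomain K 𝓕)
    {Ψ : GaloisRepresentations.ideleGroup K → ℂ} (hΨ : Measurable Ψ) {C : ℝ} (hΨC : ∀ x, ‖Ψ x‖ ≤ C)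
    (hΨK : ∀ k ∈ GaloisRepresentations.principalIdeles K, ∀ x, Ψ (k * x) = Ψ x)
    (hΨM : ∀ (r : ℝ≥0ˣ) (x : GaloisRepresentations.ideleGroup K), Ψ (posRealIdele K r * x) = Ψ x)
    {s : ℂ} (hs : 0 < s.re) {T₀ : ℝ} (hT : 0 < T₀) :
    IntegrableOn (fun x => ((IdeleClassGroup.ideleNorm K x : ℝ) : ℂ) ^ (-s) * Ψ x) ({x | T₀ < (IdeleClassGroup.ideleNorm K x : ℝ)} ∩ 𝓕) ν ∧
      ∫ x in {x | T₀ < (IdeleClassGroup.ideleNorm K x : ℝ)} ∩ 𝓕, ((IdeleClassGroup.ideleNorm K x : ℝ) : ℂ) ^ (-s) * Ψ x ∂ν =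
        (((T₀ : ℝ) : ℂ) ^ (-s) / s) * ∫ x in {x | (IdeleClassGroup.ideleNorm K x : ℝ) ≤ 1} ∩ 𝓕, ((IdeleClassGroup.ideleNorm K x : ℝ) : ℂ) * Ψ x ∂ν := by
  have hs' : (-s).re < 0 := by simpa using hs
  have hfun : ∀ x : GaloisRepresentations.ideleGroup K, ((IdeleClassGroup.ideleNorm K x : ℝ) : ℂ) ^ (-s) = (fun u : ℝ => Complex.exp (-s * u)) (logNorm K x) :=
    fun x => ideleNorm_cpow_eq_exp x (-s)
  simp_rw [hfun]
  rw [setOf_lt_ideleNorm_eq hT, bracket_eq_shellIntegral ν h𝓕 hΨ hΨC hΨK hΨM]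
  obtain ⟨hi, he⟩ := integrableOn_and_setIntegral_comp_logNorm_mul ν h𝓕 hΨ hΨC hΨK hΨM measurableSet_Ioi (integrableOn_exp_mul_complex_Ioi hs' (Real.log T₀))
  refine ⟨hi, ?_⟩
  rw [he, integral_exp_mul_complex_Ioi hs', ← ofReal_cpow_eq_exp hT, neg_div, ← div_neg, neg_neg, mul_comm]

end Mellin

/-! ## §3 The brackets `[1] = V` and `[η] = 0` -/

section Bracket

variable [MeasurableSpace (GaloisRepresentations.ideleGroup K)] [BorelSpace (GaloisRepresentations.ideleGroup K)]

/-- **`[1] = V`**: `∫_{𝓕 ∩ {‖x‖ ≤ 1}} ‖x‖ dν = idelicCovolume K ν` (★ Tate at `s = 1`). [cite: CasselsFrohlichANT1967, Ch. XV Thm. 4.4.1 (proof, Lemma B)] -/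
theorem bracket_one (ν : Measure (GaloisRepresentations.ideleGroup K)) [ν.IsMulLeftInvariant]
    [IsFiniteMeasureOnCompacts ν] [ν.IsOpenPosMeasure] {𝓕 : Set (GaloisRepresentations.ideleGroup K)}
    (h𝓕 : IsFundamentalDomain (GaloisRepresentations.principalIdeles K) 𝓕 ν) :
    ∫ x in {x | (IdeleClassGroup.ideleNorm K x : ℝ) ≤ 1} ∩ 𝓕, ((IdeleClassGroup.ideleNorm K x : ℝ) : ℂ) ∂ν = ((idelicCovolume K ν).toReal : ℂ) := by
  have h := (integrableOn_and_setIntegral_ideleNorm_cpow_of_le ν h𝓕 (s := 1) (by norm_num) one_pos).2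
  simp only [Complex.cpow_one, Complex.ofReal_one, div_one, mul_one] at h
  exact h

/-- **`[η] = 0`**: for a multiplicative, measurable, bounded `η : 𝕀_K →* ℂ` trivial on `K^×` and on `M` with `η x₀ ≠ 1` for some `x₀`, the bracket vanishes:
`∫_{𝓕 ∩ {‖x‖ ≤ 1}} ‖x‖ η dν = 0` (§2 `bracket_eq_shellIntegral` + part 1's orthogonality `shellIntegral_character_eq_zero`) — the Maass–Selberg cross terms of inequivalent characters drop.
[cite: WeilBNT1967, Ch. VII §5] [cite: MoeglinWaldspurger1995, IV.2.1] -/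
theorem bracket_character_eq_zero (ν : Measure (GaloisRepresentations.ideleGroup K)) [ν.IsMulLeftInvariant]
    [IsFiniteMeasureOnCompacts ν] [ν.IsOpenPosMeasure] {𝓕 : Set (GaloisRepresentations.ideleGroup K)} (h𝓕 : IsIdeleClassDomain K 𝓕)
    (η : GaloisRepresentations.ideleGroup K →* ℂ) (hηm : Measurable η) {C : ℝ} (hηC : ∀ x, ‖η x‖ ≤ C)
    (hηK : ∀ k ∈ GaloisRepresentations.principalIdeles K, η k = 1) (hηM : ∀ r : ℝ≥0ˣ, η (posRealIdele K r) = 1)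
    {x₀ : GaloisRepresentations.ideleGroup K} (hx₀ : η x₀ ≠ 1) :
    ∫ x in {x | (IdeleClassGroup.ideleNorm K x : ℝ) ≤ 1} ∩ 𝓕, ((IdeleClassGroup.ideleNorm K x : ℝ) : ℂ) * η x ∂ν = 0 := by
  rw [bracket_eq_shellIntegral ν h𝓕 hηm hηC (fun k hk x => by rw [map_mul, hηK k hk, one_mul]) (fun r x => by rw [map_mul, hηM r, one_mul]),
    shellIntegral_character_eq_zero ν h𝓕 η hηK hηM hx₀]

end Bracket

/-! ## §4 The torus reading of the mirror term (`U(J₃)`, covering-weight currency; the `≤`-side is ★ p857444 §3 and is not restated) -/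

section MirrorIdele

variable [MeasurableSpace (GaloisRepresentations.ideleGroup K)] [BorelSpace (GaloisRepresentations.ideleGroup K)]

/-- **`∫⁻_𝓕 𝟙{T₀ < ‖x‖} ‖x‖^{-σ} dν = V · T₀^{-σ}∕σ`** (`σ > 0` real, `ℝ≥0∞` version of the mirror formula). [cite: CasselsFrohlichANT1967, Ch. XV Thm. 4.4.1 (proof)] -/
theorem setLIntegral_indicator_lt_rpow_neg (ν : Measure (GaloisRepresentations.ideleGroup K))
    [ν.IsMulLeftInvariant] [IsFiniteMeasureOnCompacts ν] {𝓕 : Set (GaloisRepresentations.ideleGroup K)}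
    (h𝓕 : IsFundamentalDomain (GaloisRepresentations.principalIdeles K) 𝓕 ν) {σ : ℝ} (hσ : 0 < σ) {T₀ : ℝ} (hT : 0 < T₀) :
    ∫⁻ x in 𝓕, {x : GaloisRepresentations.ideleGroup K | T₀ < (IdeleClassGroup.ideleNorm K x : ℝ)}.indicator
        (fun x => ENNReal.ofReal ((IdeleClassGroup.ideleNorm K x : ℝ) ^ (-σ))) x ∂ν = idelicCovolume K ν * ENNReal.ofReal (T₀ ^ (-σ) / σ) := by
  have hσ' : -σ < 0 := neg_lt_zero.2 hσ
  have hm : Measurable fun u : ℝ => (Ioi (Real.log T₀)).indicator (fun u => ENNReal.ofReal (Real.exp (-σ * u))) u :=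
    (ENNReal.measurable_ofReal.comp (Real.measurable_exp.comp (measurable_const.mul measurable_id))).indicator measurableSet_Ioi
  have h := lintegral_comp_logNorm_eq ν h𝓕 hm
  rw [show (fun x => {x : GaloisRepresentations.ideleGroup K | T₀ < (IdeleClassGroup.ideleNorm K x : ℝ)}.indicator
      (fun x => ENNReal.ofReal ((IdeleClassGroup.ideleNorm K x : ℝ) ^ (-σ))) x) = fun x => (fun u : ℝ => (Ioi (Real.log T₀)).indicator
      (fun u => ENNReal.ofReal (Real.exp (-σ * u))) u) (logNorm K x) from indicator_lt_rpow_neg_eq_comp_logNorm hT σ, h,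
    lintegral_indicator measurableSet_Ioi,
    ← ofReal_integral_eq_lintegral_ofReal (integrableOn_exp_mul_Ioi hσ' _) (Eventually.of_forall fun u => (Real.exp_pos _).le),
    integral_exp_mul_Ioi hσ', Real.rpow_def_of_pos hT, mul_comm (Real.log T₀) (-σ), neg_div_neg_eq]

end MirrorIdele

section Torus

open Literature.MeasureTheory.Group Literature.NumberTheory.Automorphic.UnitaryGroup
open Summit.HodgeConjecture.HodgeConjecture.Cruxes.H413.K2E1BorelParabolicIntegralU3 (borelHeight_coe_eq_ideleNorm_diagUnit)

variable {F E : Type} [Field F] [NumberField F] [Field E] [NumberField E] [Algebra F E] {c : E ≃ₐ[F] E}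
variable [MeasurableSpace (quasiSplit F E c 3).Adelic] [BorelSpace (quasiSplit F E c 3).Adelic]

/-- **THE MIRROR TORUS FACTOR ON `U(J₃)`.**  For `[E:F] = 2`, `c² = 1`, `c ≠ 1`, a Haar measure `μ_T` on `T(𝔸_F) = torusInBorel F E c 3` and `σ > 0` there is `K₁ ∈ (0, ∞)` with
  `∫⁻_{T(𝔸_F)} 𝟙{C₀ < H(t)} · H(t)^{-σ} · w_T(t) dμ_T = K₁ · C₀^{-σ} ∕ σ`
for EVERY covering weight `w_T` of the rational torus `T(F)_T` and every `C₀ > 0` — `H(t) = ‖d₀ t‖` (★ p857444 `borelHeight_coe_eq_ideleNorm_diagUnit`), the torus-to-idele unfolding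
along `d₀` (★ (C-torus) `exists_lintegral_comp_diagUnitZero_mul_weight_eq_setLIntegral`, `E^×`-invariant integrand `𝟙{C₀ < ‖x‖} ‖x‖^{-σ}`) and the mirror Tate formula
`setLIntegral_indicator_lt_rpow_neg`.  The twin of the `≤`-side ★ p857444 `exists_lintegral_indicator_borelHeight_rpow_mul_weight_torus_eq`; the `U(1)`-coordinate of `T` is
integrated out inside `K₁` (integrands depending on it are not covered). [cite: Rogawski1990, §7.3 (p. 97)] [cite: CasselsFrohlichANT1967, Ch. XV Thm. 4.4.1 (proof)]
[cite: MoeglinWaldspurger1995, IV.2.1] -/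
theorem exists_lintegral_indicator_borelHeight_rpow_neg_mul_weight_torus_eq (h2 : Module.finrank F E = 2)
    (hc : c * c = 1) (hc1 : c ≠ 1) (μT : Measure (torusInBorel F E c 3)) [μT.IsHaarMeasure] {σ : ℝ} (hσ : 0 < σ) :
    ∃ K₁ : ℝ≥0∞, K₁ ≠ 0 ∧ K₁ ≠ ∞ ∧
      ∀ wT : torusInBorel F E c 3 → ℝ≥0∞,
        IsCoveringWeight ↥((((quasiSplit F E c 3).arithmeticSubgroup).subgroupOf (borelAdelic F E c 3)).subgroupOf
          (torusInBorel F E c 3)) wT →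
        ∀ C₀ : ℝ≥0, 0 < C₀ →
          ∫⁻ t, {t : torusInBorel F E c 3 | C₀ < borelHeight ((t : borelAdelic F E c 3) : (quasiSplit F E c 3).Adelic)}.indicator
              (fun t => ENNReal.ofReal ((borelHeight ((t : borelAdelic F E c 3) : (quasiSplit F E c 3).Adelic) : ℝ) ^ (-σ))) t *
            wT t ∂μT = K₁ * ENNReal.ofReal ((C₀ : ℝ) ^ (-σ) / σ) := by
  classical
  -- Borel structure and a Haar measure on `𝕀_E` (as in ★ p857444 §3)
  letI : MeasurableSpace (AdeleRing (𝓞 E) E)ˣ := borel _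
  haveI : BorelSpace (AdeleRing (𝓞 E) E)ˣ := ⟨rfl⟩
  obtain ⟨hI1, hI2, hI3⟩ := locallyCompactSpace_secondCountable_t2_idele (E := E)
  set μE : Measure (AdeleRing (𝓞 E) E)ˣ := Measure.haar with hμE
  obtain ⟨𝓕, h𝓕⟩ := exists_isIdeleClassDomain E
  obtain ⟨C, hC0, hCt, hC⟩ := exists_lintegral_comp_diagUnitZero_mul_weight_eq_setLIntegral h2 hc hc1 μT μE
  refine ⟨C * idelicCovolume E μE, mul_ne_zero hC0 (idelicCovolume_pos μE).ne', ENNReal.mul_ne_top hCt (idelicCovolume_ne_top μE),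
    fun wT hwT C₀ hC₀ => ?_⟩
  have hC₀' : (0 : ℝ) < (C₀ : ℝ) := NNReal.coe_pos.2 hC₀
  -- the integrand as an `E^×`-invariant function of `d₀ t`
  set G : (AdeleRing (𝓞 E) E)ˣ → ℝ≥0∞ := fun x => {x : (AdeleRing (𝓞 E) E)ˣ | ((C₀ : ℝ≥0) : ℝ) < (IdeleClassGroup.ideleNorm E x : ℝ)}.indicator
    (fun x => ENNReal.ofReal ((IdeleClassGroup.ideleNorm E x : ℝ) ^ (-σ))) x with hG
  have hGeq : G = (fun u : ℝ => (Ioi (Real.log C₀)).indicator (fun u => ENNReal.ofReal (Real.exp (-σ * u))) u) ∘ logNorm E :=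
    indicator_lt_rpow_neg_eq_comp_logNorm (K := E) hC₀' σ
  have hGm : Measurable G := by
    rw [hGeq]
    exact ((ENNReal.measurable_ofReal.comp (Real.measurable_exp.comp (measurable_const.mul measurable_id))).indicator measurableSet_Ioi).comp
      (continuous_logNorm E).measurable
  have hGinv : ∀ k ∈ GaloisRepresentations.principalIdeles E, ∀ x, G (k * x) = G x := fun k hk x => by
    rw [hGeq, Function.comp_apply, Function.comp_apply, logNorm_principal_mul hk]
  have hψ : ∀ t : torusInBorel F E c 3,
      {t : torusInBorel F E c 3 | C₀ < borelHeight ((t : borelAdelic F E c 3) : (quasiSplit F E c 3).Adelic)}.indicator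
          (fun t => ENNReal.ofReal ((borelHeight ((t : borelAdelic F E c 3) : (quasiSplit F E c 3).Adelic) : ℝ) ^ (-σ))) t * wT t =
        G (diagUnit (t : borelAdelic F E c 3).2 0) * wT t := by
    intro t
    simp only [hG, Set.indicator, Set.mem_setOf_eq, borelHeight_coe_eq_ideleNorm_diagUnit, NNReal.coe_lt_coe]
  simp_rw [hψ]
  have hwT' : IsCoveringWeight ((rationalBorel F E c 3).subgroupOf (torusInBorel F E c 3)) wT := hwT
  rw [hC wT hwT' 𝓕 h𝓕 G hGm hGinv, hG, setLIntegral_indicator_lt_rpow_neg μE (h𝓕.isFundamentalDomain μE) hσ hC₀', mul_assoc]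

end Torus

end Summit.HodgeConjecture.HodgeConjecture.Cruxes.H413.K2E1TorusHeightMellin

end
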